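import Literature.AnabelianGeometry.SemiGraphs.TemperedAnchoredCompactOfAbelianEdges
import Literature.AnabelianGeometry.SemiGraphs.MetabelianLeafStarElevated
import Literature.AnabelianGeometry.SemiGraphs.ThetaRayRefutation
import HarnessLib

/-!
# Compact subgroups of `π₁^temp(𝒢)` are VERTICIAL-CONTAINED or COMMUTATIVE, whenever the edge groups are
# commutative — any countable `𝒢`, cores allowed (proof-only)

Mochizuki, *Semi-graphs of anabelioids*, Publ. RIMS **42** (2006), §3, Theorem 3.7 (iii)–(iv) pp. 40–41 ("any
compact subgroup of `π₁^temp(𝒢)` is contained in at least one verticial subgroup"; "the maximal compact subgroups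
of `π₁^temp(𝒢)` are precisely the verticial subgroups"), Remark 2.2.1 p. 24 [cite: MochizukiSemiAnbd2006, Thm 3.7(iii) pp.40-41].

PROOF-ONLY file (abc-iut cell, layer L3, row «ANCHORED@STAR» sequel, seat abc-iut-w6-d064 gen 7; no definition, no
named fact).  The case analysis behind this seat's anchored theorem (`TemperedAnchoredCompactOfAbelianEdges.lean`,
✓) does not use the anchor nor the absence of a core until its last line; read on its own it gives, for EVERY
countable `𝒢` satisfying the hypotheses of [SemiAnbd] Prop 3.6 whose EDGE GROUPS ARE COMMUTATIVE (no condition on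
`𝔾`: infinite valence, rays and infinitely-branching cores allowed), at EVERY chart:

* `le_verticial_or_commutative_of_commEdges` — **every compact subgroup `K ≤ π₁^temp(𝒢)` EITHER lies in a verticial
  subgroup OR is COMMUTATIVE.**  (The `K`-fixed subtrees `F_j ⊆ 𝒢_{∞,j}` are non-empty, [SemiAnbd] Lemma 1.8 (ii);
  if `F_j` is one vertex for cofinally many `j` these vertices are compatible and (I2) `stab` applies; otherwise
  from some level on `K` fixes a branch at a fixed vertex, its level components lie in ONE conjugate
  `σ_n^{f·b_*(Π_e)·f⁻¹}` of the commutative edge image (`PointSeq.proj_mul_comm_of_branchMap_eq`), and `π₁^temp = lim`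
  separates points.)

Hence (same generality): `exists_verticial_ge_of_not_commutative_of_commEdges` — every NON-commutative compact
subgroup lies in a verticial subgroup; `commutative_of_forall_not_le_verticial_of_commEdges` — every compact
subgroup lying in NO verticial subgroup (every violator of the ∃-sentence of Thm 3.7 (iii), every «exotic» compact)
is commutative; `mem_verticialSubgroups_or_commutative_of_isMaximalCompactSubgroup_of_commEdges` — **every maximal
compact subgroup is a VERTICIAL subgroup or COMMUTATIVE** (Thm 3.7 (iv) up to abelian exotics).  Instances,
hypothesis-free: the rayless star `𝒢⋆(p)` (abc-iut-L3-t8) and the ray `𝒢_θ(p, n)` (abc-iut-L3-d1/d4), whose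
escaping / exotic compact subgroups (p489415; `ThetaRayRefutation`, abc-iut-w6-d063's exotic maximal compact) are
therefore ALL commutative.  The anchored form on the no-core class is `TemperedAnchoredCompactOfAbelianEdges.lean`
(commutative + anchored ⇒ inside the anchor's host by abc-iut-f-176's centraliser theorem).

Honest framing: OUR typed tempered fundamental groups; nothing asserted for commutative compact subgroups of graphs
with a core; nothing bears on [IUTchIII] Cor. 3.12; typed ≠ proved.
-/

namespace Literature.AnabelianGeometry.SemiGraphs

namespace ProfiniteSemiGraph

open CategoryTheory Topology

universe u

variable (𝒢 : ProfiniteSemiGraph.{u})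

/-- **Compact ⇒ verticial-contained or commutative, at the CANONICAL chart** of a countable `𝒢` (hypotheses of
Prop 3.6) with commutative edge groups. [cite: MochizukiSemiAnbd2006, Thm 3.7(iii) pp.40-41] -/
theorem le_verticial_or_commutative_of_commEdges_canonical (h36 : 𝒢.Prop36Hypotheses)
    (hab : ∀ (e : 𝒢.graph.Edge) (k k' : 𝒢.Ge e), k * k' = k' * k)
    (K : Subgroup (𝒢.temperedPiChart h36).G) (hKc : IsCompact (K : Set (𝒢.temperedPiChart h36).G)) :
    (∃ (v : 𝒢.graph.Vertex) (H : Subgroup (𝒢.temperedPiChart h36).G),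
        H ∈ verticialSubgroups (𝒢.temperedPiChart h36) v ∧ K ≤ H) ∨
      ∀ g₁ ∈ K, ∀ g₂ ∈ K, g₁ * g₂ = g₂ * g₁ := by
  classical
  let D₀ : VerticialLevelData.{0} 𝒢 (𝒢.temperedPiChart h36) := verticialLevelData_temperedPiChart (h36 := h36)
  -- [SemiAnbd] Lemma 1.8 (ii): the compact `K` fixes a vertex of every `𝒢_{∞,j}`
  have hfixK : ∀ j : D₀.J, ∃ z : (D₀.tree j).Vertex, ∀ g ∈ K, (D₀.act j g).hom.vertexMap z = z := by
    intro j
    obtain ⟨z, hz⟩ := SemiGraph.exists_fixed_vertex_of_isCompact_over K hKc (D₀.isTree j) (D₀.vertex j)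
      (D₀.proj j) (D₀.act j) (D₀.isOpen_ker j) (D₀.act_over j)
    exact ⟨z, fun g hg => hz ⟨g, hg⟩⟩
  by_cases hA : ∀ j₁ : D₀.J, ∃ j : D₀.J, j₁ ≤ j ∧ ∀ z z' : (D₀.tree j).Vertex,
      (∀ g ∈ K, (D₀.act j g).hom.vertexMap z = z) → (∀ g ∈ K, (D₀.act j g).hom.vertexMap z' = z') → z = z'
  · /- (A) cofinally ONE fixed vertex: the fixed vertices are compatible; (I2). -/
    left
    choose φ hφle hφuniq using hA
    choose z hz using hfixK
    have hzimg : ∀ (i : D₀.J) (m : D₀.J) (h : φ i ≤ m), (D₀.trans h).vertexMap (z m) = z (φ i) := by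
      intro i m h
      refine hφuniq i _ _ (fun g hg => ?_) (hz (φ i))
      rw [← D₀.trans_act_vertexMap h g (z m), hz m g hg]
    let y : ∀ i : D₀.J, (D₀.tree i).Vertex := fun i => (D₀.trans (hφle i)).vertexMap (z (φ i))
    have hy : ∀ ⦃i i' : D₀.J⦄ (h : i ≤ i'), (D₀.trans h).vertexMap (y i') = y i := by
      intro i i' h
      obtain ⟨M, hM, hM'⟩ := exists_ge_ge (φ i) (φ i')
      change (D₀.trans h).vertexMap ((D₀.trans (hφle i')).vertexMap (z (φ i'))) =
        (D₀.trans (hφle i)).vertexMap (z (φ i))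
      rw [← hzimg i M hM, ← hzimg i' M hM', D₀.trans_vertexMap_comp, D₀.trans_vertexMap_comp,
        D₀.trans_vertexMap_comp]
    have hfy : ∀ g ∈ K, ∀ i, (D₀.act i g).hom.vertexMap (y i) = y i := by
      intro g hg i
      change (D₀.act i g).hom.vertexMap ((D₀.trans (hφle i)).vertexMap (z (φ i))) =
        (D₀.trans (hφle i)).vertexMap (z (φ i))
      rw [← D₀.trans_act_vertexMap (hφle i) g, hz (φ i) g hg]
    obtain ⟨v, H, hH, hst⟩ := D₀.stab y hy
    exact ⟨v, H, hH, fun g hg => hst g fun i => hfy g hg i⟩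
  · /- (B) eventually TWO fixed vertices: a fixed branch at a fixed vertex; the level components commute. -/
    right
    push Not at hA
    obtain ⟨j₁, hj₁⟩ := hA
    intro g₁ hg₁ g₂ hg₂
    refine GaloisLevelData.eq_of_forall_proj_eq_of_le (D := 𝒢.galoisLevelData h36) (h𝒢 := h36.isCountable) j₁
      fun m hm => ?_
    obtain ⟨z, z', hz, hz', hne⟩ := hj₁ m hm
    obtain ⟨β, hβz, hβfix⟩ := D₀.exists_fixed_branch_of_two_fixed_vertices K m hne hz hz'
    obtain ⟨P, hP⟩ := exists_pointSeq_vertex_eq_galoisLevelData h36 m z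
    have hb : 𝒢.graph.abuts (((𝒢.galoisLevelData h36).treeProj m).branchMap β) =
        some (((𝒢.galoisLevelData h36).treeProj m).vertexMap z) :=
      ((𝒢.galoisLevelData h36).treeProj m).abuts_branchMap β z hβz
    exact P.proj_mul_comm_of_branchMap_eq m _ hb (hab _) β rfl (hP.symm ▸ hβz) g₁ g₂ (hβfix g₁ hg₁) (hβfix g₂ hg₂)

variable {𝒢}

/-- **Every compact subgroup of `π₁^temp(𝒢)` is VERTICIAL-CONTAINED or COMMUTATIVE** — for every countable `𝒢`
satisfying the hypotheses of [SemiAnbd] Prop 3.6 whose edge groups are commutative (infinite valence and cores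
allowed), at EVERY chart (transport along `TemperedPiChart.exists_compatIso`).
[cite: MochizukiSemiAnbd2006, Thm 3.7(iii) pp.40-41] -/
theorem le_verticial_or_commutative_of_commEdges (h36 : 𝒢.Prop36Hypotheses)
    (hab : ∀ (e : 𝒢.graph.Edge) (k k' : 𝒢.Ge e), k * k' = k' * k)
    (c : TemperedPiChart 𝒢) (K : Subgroup c.G) (hKc : IsCompact (K : Set c.G)) :
    (∃ (v : 𝒢.graph.Vertex) (H : Subgroup c.G), H ∈ verticialSubgroups c v ∧ K ≤ H) ∨
      ∀ g₁ ∈ K, ∀ g₂ ∈ K, g₁ * g₂ = g₂ * g₁ := by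
  obtain ⟨φ, ψ, hψφ, hφψ, hφ, hψ⟩ := TemperedPiChart.exists_compatIso (𝒢.temperedPiChart h36) c
  have hinj : Function.Injective ψ := fun y₁ y₂ h => by rw [← hφψ y₁, ← hφψ y₂, h]
  have hK' : IsCompact (K.map ψ.toMonoidHom : Set (𝒢.temperedPiChart h36).G) := by
    rw [Subgroup.coe_map]
    exact hKc.image ψ.continuous
  rcases 𝒢.le_verticial_or_commutative_of_commEdges_canonical h36 hab (K.map ψ.toMonoidHom) hK' with
    ⟨v, H', hH', hKH'⟩ | hcomm
  · refine Or.inl ⟨v, H'.map φ.toMonoidHom, mem_verticialSubgroups_map φ hφ hH', fun g hg => ?_⟩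
    exact ⟨ψ g, hKH' ⟨g, hg, rfl⟩, hφψ g⟩
  · refine Or.inr fun g₁ hg₁ g₂ hg₂ => hinj ?_
    have h := hcomm (ψ g₁) ⟨g₁, hg₁, rfl⟩ (ψ g₂) ⟨g₂, hg₂, rfl⟩
    simpa only [map_mul] using h

/-- **Every NON-commutative compact subgroup of `π₁^temp(𝒢)` lies in a verticial subgroup** (countable `𝒢` as in
Prop 3.6, commutative edge groups, every chart). [cite: MochizukiSemiAnbd2006, Thm 3.7(iii) pp.40-41] -/
theorem exists_verticial_ge_of_not_commutative_of_commEdges (h36 : 𝒢.Prop36Hypotheses)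
    (hab : ∀ (e : 𝒢.graph.Edge) (k k' : 𝒢.Ge e), k * k' = k' * k)
    (c : TemperedPiChart 𝒢) (K : Subgroup c.G) (hKc : IsCompact (K : Set c.G))
    (hK : ∃ g₁ ∈ K, ∃ g₂ ∈ K, g₁ * g₂ ≠ g₂ * g₁) :
    ∃ (v : 𝒢.graph.Vertex) (H : Subgroup c.G), H ∈ verticialSubgroups c v ∧ K ≤ H := by
  rcases le_verticial_or_commutative_of_commEdges h36 hab c K hKc with h | h
  · exact h
  · obtain ⟨g₁, hg₁, g₂, hg₂, hne⟩ := hK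
    exact absurd (h g₁ hg₁ g₂ hg₂) hne

/-- **Every compact subgroup of `π₁^temp(𝒢)` lying in NO verticial subgroup is COMMUTATIVE** — in particular every
violator of the ∃-sentence of Thm 3.7 (iii) and every «exotic» compact subgroup (countable `𝒢` as in Prop 3.6,
commutative edge groups, every chart). [cite: MochizukiSemiAnbd2006, Thm 3.7(iii) pp.40-41] -/
theorem commutative_of_forall_not_le_verticial_of_commEdges (h36 : 𝒢.Prop36Hypotheses)
    (hab : ∀ (e : 𝒢.graph.Edge) (k k' : 𝒢.Ge e), k * k' = k' * k)
    (c : TemperedPiChart 𝒢) (K : Subgroup c.G) (hKc : IsCompact (K : Set c.G))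
    (hno : ∀ (v : 𝒢.graph.Vertex) (H : Subgroup c.G), H ∈ verticialSubgroups c v → ¬ K ≤ H) :
    ∀ g₁ ∈ K, ∀ g₂ ∈ K, g₁ * g₂ = g₂ * g₁ := by
  rcases le_verticial_or_commutative_of_commEdges h36 hab c K hKc with ⟨v, H, hH, hle⟩ | h
  · exact absurd hle (hno v H hH)
  · exact h

/-- **Every MAXIMAL compact subgroup of `π₁^temp(𝒢)` is a VERTICIAL subgroup or COMMUTATIVE** (countable `𝒢` as
in Prop 3.6, commutative edge groups, every chart): a maximal compact subgroup inside a verticial (hence compact,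
`isCompact_of_mem_verticialSubgroups`) subgroup equals it.  Thm 3.7 (iv), first sentence, up to commutative exotic
maximal compact subgroups. [cite: MochizukiSemiAnbd2006, Thm 3.7(iv) p.41] -/
theorem mem_verticialSubgroups_or_commutative_of_isMaximalCompactSubgroup_of_commEdges (h36 : 𝒢.Prop36Hypotheses)
    (hab : ∀ (e : 𝒢.graph.Edge) (k k' : 𝒢.Ge e), k * k' = k' * k)
    (c : TemperedPiChart 𝒢) (K : Subgroup c.G) (hK : IsMaximalCompactSubgroup K) :
    (∃ v : 𝒢.graph.Vertex, K ∈ verticialSubgroups c v) ∨ ∀ g₁ ∈ K, ∀ g₂ ∈ K, g₁ * g₂ = g₂ * g₁ := by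
  rcases le_verticial_or_commutative_of_commEdges h36 hab c K hK.1 with ⟨v, H, hH, hle⟩ | h
  · exact Or.inl ⟨v, (hK.2 H (isCompact_of_mem_verticialSubgroups c hH) hle) ▸ hH⟩
  · exact Or.inr h

/-- **A non-commutative maximal compact subgroup IS a verticial subgroup** (countable `𝒢` as in Prop 3.6,
commutative edge groups, every chart). [cite: MochizukiSemiAnbd2006, Thm 3.7(iv) p.41] -/
theorem exists_mem_verticialSubgroups_of_isMaximalCompactSubgroup_of_not_commutative_of_commEdges
    (h36 : 𝒢.Prop36Hypotheses) (hab : ∀ (e : 𝒢.graph.Edge) (k k' : 𝒢.Ge e), k * k' = k' * k)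
    (c : TemperedPiChart 𝒢) (K : Subgroup c.G) (hK : IsMaximalCompactSubgroup K)
    (hK' : ∃ g₁ ∈ K, ∃ g₂ ∈ K, g₁ * g₂ ≠ g₂ * g₁) : ∃ v : 𝒢.graph.Vertex, K ∈ verticialSubgroups c v := by
  rcases mem_verticialSubgroups_or_commutative_of_isMaximalCompactSubgroup_of_commEdges h36 hab c K hK with h | h
  · exact h
  · obtain ⟨g₁, hg₁, g₂, hg₂, hne⟩ := hK'
    exact absurd (h g₁ hg₁ g₂ hg₂) hne

/-! ### Instances: the rayless star `𝒢⋆(p)` and the ray `𝒢_θ(p, n)` -/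

section Instances

variable (p : ℕ) [hp : Fact p.Prime] (n : ℕ → ℕ)

/-- **At `𝒢⋆(p)`** (edge groups `ℤ_p`): every compact subgroup of `π₁^temp(𝒢⋆(p))` lies in a verticial subgroup or
is commutative — every chart, hypothesis-free. [cite: MochizukiSemiAnbd2006, Thm 3.7(iii) pp.40-41] -/
theorem metabelianLeafStar_le_verticial_or_commutative (c : TemperedPiChart (metabelianLeafStar p))
    (K : Subgroup c.G) (hKc : IsCompact (K : Set c.G)) :
    (∃ (v : (metabelianLeafStar p).graph.Vertex) (H : Subgroup c.G), H ∈ verticialSubgroups c v ∧ K ≤ H) ∨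
      ∀ g₁ ∈ K, ∀ g₂ ∈ K, g₁ * g₂ = g₂ * g₁ :=
  le_verticial_or_commutative_of_commEdges (metabelianLeafStar_thm37Hypotheses' p).toProp36Hypotheses
    (fun _ k k' => mul_comm (G := Multiplicative ℤ_[p]) k k') c K hKc

/-- **At `𝒢⋆(p)`: every compact subgroup lying in no verticial subgroup — e.g. the escaping `⟨c⟩‾` of
abc-iut-L3-t8 (p489415) — is COMMUTATIVE**; every chart. [cite: MochizukiSemiAnbd2006, Thm 3.7(iii) pp.40-41] -/
theorem metabelianLeafStar_commutative_of_forall_not_le_verticial (c : TemperedPiChart (metabelianLeafStar p))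
    (K : Subgroup c.G) (hKc : IsCompact (K : Set c.G))
    (hno : ∀ (v : (metabelianLeafStar p).graph.Vertex) (H : Subgroup c.G), H ∈ verticialSubgroups c v → ¬ K ≤ H) :
    ∀ g₁ ∈ K, ∀ g₂ ∈ K, g₁ * g₂ = g₂ * g₁ :=
  commutative_of_forall_not_le_verticial_of_commEdges (metabelianLeafStar_thm37Hypotheses' p).toProp36Hypotheses
    (fun _ k k' => mul_comm (G := Multiplicative ℤ_[p]) k k') c K hKc hno

/-- **At `𝒢⋆(p)`: every maximal compact subgroup of `π₁^temp(𝒢⋆(p))` is verticial or commutative**; every chart.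
[cite: MochizukiSemiAnbd2006, Thm 3.7(iv) p.41] -/
theorem metabelianLeafStar_mem_verticialSubgroups_or_commutative_of_isMaximalCompactSubgroup
    (c : TemperedPiChart (metabelianLeafStar p)) (K : Subgroup c.G) (hK : IsMaximalCompactSubgroup K) :
    (∃ v : (metabelianLeafStar p).graph.Vertex, K ∈ verticialSubgroups c v) ∨
      ∀ g₁ ∈ K, ∀ g₂ ∈ K, g₁ * g₂ = g₂ * g₁ :=
  mem_verticialSubgroups_or_commutative_of_isMaximalCompactSubgroup_of_commEdges
    (metabelianLeafStar_thm37Hypotheses' p).toProp36Hypotheses (fun _ k k' => mul_comm (G := Multiplicative ℤ_[p]) k k')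
    c K hK

/-- **At the ray `𝒢_θ(p, n)`** (edge groups `ℤ_p`): every compact subgroup of `π₁^temp(𝒢_θ)` lies in a verticial
subgroup or is commutative — every chart, hypothesis-free. [cite: MochizukiSemiAnbd2006, Thm 3.7(iii) pp.40-41] -/
theorem thetaRayFreeProP_le_verticial_or_commutative (c : TemperedPiChart (thetaRayFreeProP p n))
    (K : Subgroup c.G) (hKc : IsCompact (K : Set c.G)) :
    (∃ (v : (thetaRayFreeProP p n).graph.Vertex) (H : Subgroup c.G), H ∈ verticialSubgroups c v ∧ K ≤ H) ∨
      ∀ g₁ ∈ K, ∀ g₂ ∈ K, g₁ * g₂ = g₂ * g₁ :=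
  le_verticial_or_commutative_of_commEdges (thetaRayFreeProP_thm37Hypotheses' p n).toProp36Hypotheses
    (fun _ k k' => mul_comm (G := Multiplicative ℤ_[p]) k k') c K hKc

/-- **At `𝒢_θ(p, n)`: every compact subgroup lying in no verticial subgroup — e.g. the escaping procyclic `C` of
`ThetaRayRefutation`, abc-iut-w6-d063's exotic maximal compact subgroup — is COMMUTATIVE**; every chart.
[cite: MochizukiSemiAnbd2006, Thm 3.7(iii) pp.40-41] -/
theorem thetaRayFreeProP_commutative_of_forall_not_le_verticial (c : TemperedPiChart (thetaRayFreeProP p n))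
    (K : Subgroup c.G) (hKc : IsCompact (K : Set c.G))
    (hno : ∀ (v : (thetaRayFreeProP p n).graph.Vertex) (H : Subgroup c.G), H ∈ verticialSubgroups c v → ¬ K ≤ H) :
    ∀ g₁ ∈ K, ∀ g₂ ∈ K, g₁ * g₂ = g₂ * g₁ :=
  commutative_of_forall_not_le_verticial_of_commEdges (thetaRayFreeProP_thm37Hypotheses' p n).toProp36Hypotheses
    (fun _ k k' => mul_comm (G := Multiplicative ℤ_[p]) k k') c K hKc hno

/-- **At `𝒢_θ(p, n)`: every maximal compact subgroup of `π₁^temp(𝒢_θ)` is verticial or commutative**; every chart.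
[cite: MochizukiSemiAnbd2006, Thm 3.7(iv) p.41] -/
theorem thetaRayFreeProP_mem_verticialSubgroups_or_commutative_of_isMaximalCompactSubgroup
    (c : TemperedPiChart (thetaRayFreeProP p n)) (K : Subgroup c.G) (hK : IsMaximalCompactSubgroup K) :
    (∃ v : (thetaRayFreeProP p n).graph.Vertex, K ∈ verticialSubgroups c v) ∨
      ∀ g₁ ∈ K, ∀ g₂ ∈ K, g₁ * g₂ = g₂ * g₁ :=
  mem_verticialSubgroups_or_commutative_of_isMaximalCompactSubgroup_of_commEdges
    (thetaRayFreeProP_thm37Hypotheses' p n).toProp36Hypotheses (fun _ k k' => mul_comm (G := Multiplicative ℤ_[p]) k k')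
    c K hK

end Instances

end ProfiniteSemiGraph

end Literature.AnabelianGeometry.SemiGraphs
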